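import Literature.Barriers.CriticalPhenomena.IsingTrivialityFromDimensionFourProofs
import Literature.Barriers.CriticalPhenomena.LongRangeTrivialityOnZ3LatticeSums
import Literature.Probability.LatticeModels.HighDimPointwiseTriviality
import Literature.Probability.LatticeModels.CriticalTwoPointBounds

/-!
# The critical block variance under the Coulomb bound (stub `stub_blockVariance`, line `SketchPub`)

Crux `CoulombImpliesNontrivial` of route `PerfectScreening` (Ising3DConformalLimit), registered stub S4:
if `c/‖x‖ ≤ ⟨σ₀σ_x⟩_{β_c}` on `ℤ³ ∖ 0` (Coulomb lower bound), then the critical block variance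
`Σ_L = ⟨M_L²⟩_{β_c}`, `M_L = Σ_{x ∈ box 3 L} σ_x`, satisfies `c L⁵ ≤ Σ_L ≤ C L⁵` for `L ≥ 1`.

* `plusExpect_blockSq_eq_sum`: `Σ_L = Σ_{x,y ∈ box L} ⟨σ₀σ_{y-x}⟩_{β_c}` (linearity of the plus state on
  spin products, `plusExpect_sum_spinProduct`, and translation invariance, `criticalCorr_two_pair`;
  the diagonal terms are `⟨1⟩ = 1 = ⟨σ₀σ₀⟩`).
* lower bound: every pair `x, y ∈ box L` has `‖y - x‖_∞ ≤ 2L`, so each of the `(2L+1)⁶` terms is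
  `≥ min(c,1)/(2L)`.
* upper bound: re-indexing `z = y - x ∈ box 2L` row by row, `Σ_L ≤ (2L+1)³ Σ_{z ∈ box 2L} G(z)`, and
  `Σ_{z ∈ box M} G(z) ≤ K M²` from the tree's infrared bound `G(z) ≤ C/‖z‖_∞`
  (`criticalTwoPoint_bounds_holds`) and the `ℤ³` shell sum `Σ_{0 < ‖z‖_∞ ≤ M} ‖z‖_∞⁻¹ ≤ 39 M²`
  (`LongRangeIsing.sum_box_rpow_supNorm_le` with `η = 0`).
-/

noncomputable section

namespace Summit.CriticalPhenomena.Ising3DConformalLimit.PerfectScreeningCoulombImpliesNontrivial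

open Literature.Probability.LatticeModels Filter Set Finset
open scoped Topology BigOperators
open Literature.Barriers.CriticalPhenomena

/-- **The block variance as a double sum of critical two-point functions**:
`⟨(Σ_{x ∈ box L} σ_x)²⟩_{β_c} = Σ_{(x,y) ∈ box L × box L} ⟨σ₀σ_{y-x}⟩_{β_c}` (expand the square; the plus
state is linear on spin products; `σ_x² = 1` and `⟨1⟩ = 1 = ⟨σ₀σ₀⟩`; translation invariance). -/
theorem plusExpect_blockSq_eq_sum (d L : ℕ) :
    plusExpect d (criticalBeta d) 0 (fun σ => (∑ x ∈ box d L, spinAt x σ) ^ 2) =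
      ∑ p ∈ box d L ×ˢ box d L, criticalTwoPoint d (p.2 - p.1) := by
  classical
  have hβ := criticalBeta_nonneg d
  set A : Site d × Site d → Finset (Site d) := fun p => if p.1 = p.2 then ∅ else {p.1, p.2}
    with hA
  have hexp : (fun σ : SpinConfig (Site d) => (∑ x ∈ box d L, spinAt x σ) ^ 2) =
      fun σ => ∑ p ∈ box d L ×ˢ box d L, (1 : ℝ) * spinProduct (A p) σ := by
    funext σ
    rw [sq, Finset.sum_mul_sum, ← Finset.sum_product']
    refine Finset.sum_congr rfl fun p _ => ?_
    rw [one_mul]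
    by_cases hp : p.1 = p.2
    · simp [hA, hp, spinProduct]
    · simp [hA, hp, spinProduct, Finset.prod_pair hp]
  rw [hexp, plusExpect_sum_spinProduct hβ le_rfl]
  refine Finset.sum_congr rfl fun p _ => ?_
  rw [one_mul]
  by_cases hp : p.1 = p.2
  · simp [hA, hp, plusCorr_empty hβ le_rfl, criticalTwoPoint_zero']
  · have hApair : A p = {p.1, p.2} := by simp [hA, hp]
    rw [hApair]
    change plusExpect d (criticalBeta d) 0 (spinProduct {p.1, p.2}) = _
    rw [← spinPair_eq_spinProduct hp]
    exact plusPair_eq_twoPointPlus_sub hβ p.1 p.2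

/-- **Row re-indexing**: for `x ∈ box L`, `Σ_{y ∈ box L} G(y - x) ≤ Σ_{z ∈ box 2L} G(z)` (the translate
`box L - x` lies in `box 2L`, and `G ≥ 0`). -/
theorem sum_box_criticalTwoPoint_sub_le {d L : ℕ} {x : Site d} (hx : x ∈ box d L) :
    ∑ y ∈ box d L, criticalTwoPoint d (y - x) ≤ ∑ z ∈ box d (2 * L), criticalTwoPoint d z := by
  classical
  have hinj : Set.InjOn (fun y : Site d => y - x) ↑(box d L) :=
    fun y _ y' _ h => sub_left_injective h
  calc ∑ y ∈ box d L, criticalTwoPoint d (y - x)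
      = ∑ z ∈ (box d L).image (fun y => y - x), criticalTwoPoint d z :=
        (Finset.sum_image (f := criticalTwoPoint d) hinj).symm
    _ ≤ ∑ z ∈ box d (2 * L), criticalTwoPoint d z := by
        refine Finset.sum_le_sum_of_subset_of_nonneg ?_ fun z _ _ => criticalTwoPoint_nonneg' z
        intro z hz
        rw [Finset.mem_image] at hz
        obtain ⟨y, hy, rfl⟩ := hz
        rw [mem_box] at hx hy ⊢
        intro i
        have h1 := hx i
        have h2 := hy i
        simp only [Pi.sub_apply]
        push_cast
        omega

/-- **The box sum of the critical two-point function on `ℤ³`**: `Σ_{z ∈ box M} ⟨σ₀σ_z⟩_{β_c} ≤ K M²`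
for `M ≥ 1`, from the infrared bound `⟨σ₀σ_z⟩_{β_c} ≤ C ‖z‖_∞⁻¹` (`criticalTwoPoint_bounds_holds`) and
the shell sum `Σ_{0 < ‖z‖_∞ ≤ M} ‖z‖_∞⁻¹ ≤ 39 M²`; the origin contributes `1 ≤ M²`. -/
theorem sum_box_criticalTwoPoint_le :
    ∃ K : ℝ, 0 ≤ K ∧ ∀ M : ℕ, 1 ≤ M →
      ∑ z ∈ box 3 M, criticalTwoPoint 3 z ≤ K * (M : ℝ) ^ 2 := by
  obtain ⟨c, C, -, hB⟩ := criticalTwoPoint_bounds_holds (d := 3) le_rfl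
  set C' : ℝ := max C 0 with hC'
  have hC'0 : 0 ≤ C' := le_max_right _ _
  refine ⟨1 + 39 * C', by positivity, fun M hM => ?_⟩
  have hM1 : (1 : ℝ) ≤ M := by exact_mod_cast hM
  have hM2 : (1 : ℝ) ≤ (M : ℝ) ^ 2 := by nlinarith
  -- split off the origin
  have hsplit : ∑ z ∈ box 3 M, criticalTwoPoint 3 z =
      ∑ z ∈ box 3 M \ box 3 0, criticalTwoPoint 3 z + ∑ z ∈ box 3 0, criticalTwoPoint 3 z := by
    rw [Finset.sum_sdiff (box_mono 3 (Nat.zero_le M))]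
  have hzero : ∑ z ∈ box 3 0, criticalTwoPoint 3 z ≤ 1 := by
    calc ∑ z ∈ box 3 0, criticalTwoPoint 3 z ≤ ∑ _z ∈ box 3 0, (1 : ℝ) :=
          Finset.sum_le_sum fun z _ => criticalTwoPoint_le_one' z
      _ = 1 := by rw [Finset.sum_const, card_box]; norm_num
  -- the infrared bound off the origin, with `C' = max C 0 ≥ 0`
  have hterm : ∀ z ∈ box 3 M \ box 3 0,
      criticalTwoPoint 3 z ≤ C' * ((Site.supNorm z : ℝ))⁻¹ := by
    intro z hz
    rw [Finset.mem_sdiff, mem_box_iff_supNorm_le, mem_box_iff_supNorm_le] at hz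
    have hpos : 0 < Site.supNorm z := by omega
    have hz0 : z ≠ 0 := fun h => by
      rw [h, Site.supNorm_eq_zero_iff.2 rfl] at hpos
      exact lt_irrefl 0 hpos
    have hn0 : (0 : ℝ) < Site.supNorm z := by exact_mod_cast hpos
    have h := (hB z hz0).2
    have he : -(((3 : ℕ) : ℝ) - 2) = (-1 : ℝ) := by norm_num
    rw [Site.norm_eq_supNorm, he, Real.rpow_neg_one] at h
    exact h.trans (mul_le_mul_of_nonneg_right (le_max_left C 0) (inv_nonneg.2 hn0.le))
  -- the shell sum `Σ_{0 < ‖z‖_∞ ≤ M} ‖z‖_∞⁻¹ ≤ 39 M²`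
  have hshell : ∑ z ∈ box 3 M \ box 3 0, ((Site.supNorm z : ℝ))⁻¹ ≤ 39 * (M : ℝ) ^ 2 := by
    have h := LongRangeIsing.sum_box_rpow_supNorm_le (η := 0) (by norm_num) hM
    have e : ∀ z : Site 3, ((Site.supNorm z : ℝ)) ^ (-(1 + (0 : ℝ))) = ((Site.supNorm z : ℝ))⁻¹ :=
      fun z => by rw [add_zero, Real.rpow_neg_one]
    simp only [e, sub_zero, Real.rpow_two] at h
    linarith
  calc ∑ z ∈ box 3 M, criticalTwoPoint 3 z
      = ∑ z ∈ box 3 M \ box 3 0, criticalTwoPoint 3 z + ∑ z ∈ box 3 0, criticalTwoPoint 3 z := hsplit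
    _ ≤ ∑ z ∈ box 3 M \ box 3 0, C' * ((Site.supNorm z : ℝ))⁻¹ + 1 := by
        linarith [Finset.sum_le_sum hterm, hzero]
    _ = C' * ∑ z ∈ box 3 M \ box 3 0, ((Site.supNorm z : ℝ))⁻¹ + 1 := by rw [Finset.mul_sum]
    _ ≤ C' * (39 * (M : ℝ) ^ 2) + 1 := by
        linarith [mul_le_mul_of_nonneg_left hshell hC'0]
    _ ≤ (1 + 39 * C') * (M : ℝ) ^ 2 := by nlinarith

/-- **S4 — the critical block variance under the Coulomb bound**: if `c/‖x‖ ≤ ⟨σ₀σ_x⟩_{β_c}` for all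
`x ≠ 0` in `ℤ³`, then `c' L⁵ ≤ ⟨M_L²⟩_{β_c} ≤ C L⁵` for every `L ≥ 1`, `M_L = Σ_{x ∈ box 3 L} σ_x`.
Lower bound: each of the `(2L+1)⁶` terms `⟨σ₀σ_{y-x}⟩_{β_c}`, `x, y ∈ box L`, is `≥ min(c,1)/(2L)`
(`‖y - x‖_∞ ≤ 2L`, diagonal terms `= 1`). Upper bound: `Σ_L ≤ (2L+1)³ Σ_{z ∈ box 2L} ⟨σ₀σ_z⟩ ≤
27L³ · 4KL²` by the infrared bound (`sum_box_criticalTwoPoint_le`). -/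
theorem stub_blockVariance :
    (∃ c : ℝ, 0 < c ∧ ∀ x : Site 3, x ≠ 0 → c / ‖x‖ ≤ criticalTwoPoint 3 x) →
      ∃ c C : ℝ, 0 < c ∧ ∀ L : ℕ, 1 ≤ L →
        c * (L : ℝ) ^ 5 ≤ plusExpect 3 (criticalBeta 3) 0 (fun σ => (∑ x ∈ box 3 L, spinAt x σ) ^ 2) ∧
        plusExpect 3 (criticalBeta 3) 0 (fun σ => (∑ x ∈ box 3 L, spinAt x σ) ^ 2) ≤ C * (L : ℝ) ^ 5 := by
  rintro ⟨c, hc, hCoul⟩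
  obtain ⟨K, hK0, hK⟩ := sum_box_criticalTwoPoint_le
  set c' : ℝ := min c 1 with hc'
  have hc'0 : 0 < c' := lt_min hc one_pos
  refine ⟨c', 27 * 4 * K, hc'0, fun L hL => ?_⟩
  have hL1 : (1 : ℝ) ≤ L := by exact_mod_cast hL
  have hL0 : (0 : ℝ) < L := by linarith
  rw [plusExpect_blockSq_eq_sum 3 L]
  constructor
  · -- lower bound: every term is at least `c'/(2L)`
    have hpt : ∀ p ∈ box 3 L ×ˢ box 3 L, c' / (2 * L) ≤ criticalTwoPoint 3 (p.2 - p.1) := by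
      intro p hp
      rw [Finset.mem_product] at hp
      by_cases h : p.2 - p.1 = 0
      · rw [h, criticalTwoPoint_zero']
        calc c' / (2 * L) ≤ c' := div_le_self hc'0.le (by linarith)
          _ ≤ 1 := min_le_right _ _
      · have h1 : ‖p.1‖ ≤ L := by
          rw [Site.norm_eq_supNorm]; exact_mod_cast mem_box_iff_supNorm_le.1 hp.1
        have h2 : ‖p.2‖ ≤ L := by
          rw [Site.norm_eq_supNorm]; exact_mod_cast mem_box_iff_supNorm_le.1 hp.2
        have hnorm : ‖p.2 - p.1‖ ≤ 2 * L :=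
          calc ‖p.2 - p.1‖ ≤ ‖p.2‖ + ‖p.1‖ := norm_sub_le _ _
            _ ≤ L + L := add_le_add h2 h1
            _ = 2 * L := by ring
        have hpos : 0 < ‖p.2 - p.1‖ := norm_pos_iff.2 h
        calc c' / (2 * L) ≤ c' / ‖p.2 - p.1‖ := div_le_div_of_nonneg_left hc'0.le hpos hnorm
          _ ≤ c / ‖p.2 - p.1‖ := div_le_div_of_nonneg_right (min_le_left _ _) hpos.le
          _ ≤ criticalTwoPoint 3 (p.2 - p.1) := hCoul _ h
    have hcard : #(box 3 L ×ˢ box 3 L) = (2 * L + 1) ^ 3 * (2 * L + 1) ^ 3 := by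
      rw [Finset.card_product, card_box]
    have hsum : ((2 * (L : ℝ) + 1) ^ 3 * (2 * (L : ℝ) + 1) ^ 3) * (c' / (2 * L)) ≤
        ∑ p ∈ box 3 L ×ˢ box 3 L, criticalTwoPoint 3 (p.2 - p.1) := by
      have h := Finset.card_nsmul_le_sum _ _ _ hpt
      have hcast : (((2 * L + 1) ^ 3 * (2 * L + 1) ^ 3 : ℕ) : ℝ) =
          (2 * (L : ℝ) + 1) ^ 3 * (2 * (L : ℝ) + 1) ^ 3 := by norm_cast
      rwa [hcard, nsmul_eq_mul, hcast] at h
    refine le_trans ?_ hsum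
    rw [mul_div_assoc', le_div_iff₀ (by positivity)]
    have h6 : (L : ℝ) ^ 5 * (2 * (L : ℝ)) ≤ (2 * (L : ℝ) + 1) ^ 3 * (2 * (L : ℝ) + 1) ^ 3 := by
      have e1 : (L : ℝ) ^ 5 * (2 * (L : ℝ)) = 2 * (L : ℝ) ^ 6 := by ring
      have e2 : (2 * (L : ℝ) + 1) ^ 3 * (2 * (L : ℝ) + 1) ^ 3 = (2 * (L : ℝ) + 1) ^ 6 := by ring
      rw [e1, e2]
      have h64 : 2 * (L : ℝ) ^ 6 ≤ (2 * (L : ℝ)) ^ 6 := by nlinarith [pow_nonneg hL0.le 6]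
      have h2L : (2 * (L : ℝ)) ^ 6 ≤ (2 * (L : ℝ) + 1) ^ 6 :=
        pow_le_pow_left₀ (by positivity) (by linarith) 6
      exact h64.trans h2L
    calc c' * (L : ℝ) ^ 5 * (2 * (L : ℝ)) = c' * ((L : ℝ) ^ 5 * (2 * (L : ℝ))) := by ring
      _ ≤ c' * ((2 * (L : ℝ) + 1) ^ 3 * (2 * (L : ℝ) + 1) ^ 3) :=
          mul_le_mul_of_nonneg_left h6 hc'0.le
      _ = (2 * (L : ℝ) + 1) ^ 3 * (2 * (L : ℝ) + 1) ^ 3 * c' := by ring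
  · -- upper bound: rows re-indexed into `box 2L`, then the infrared box sum
    have hrow : ∀ x ∈ box 3 L, ∑ y ∈ box 3 L, criticalTwoPoint 3 (y - x) ≤
        ∑ z ∈ box 3 (2 * L), criticalTwoPoint 3 z := fun x hx => sum_box_criticalTwoPoint_sub_le hx
    have hT := hK (2 * L) (by omega)
    calc ∑ p ∈ box 3 L ×ˢ box 3 L, criticalTwoPoint 3 (p.2 - p.1)
        = ∑ x ∈ box 3 L, ∑ y ∈ box 3 L, criticalTwoPoint 3 (y - x) := Finset.sum_product _ _ _
      _ ≤ ∑ _x ∈ box 3 L, ∑ z ∈ box 3 (2 * L), criticalTwoPoint 3 z := Finset.sum_le_sum hrow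
      _ = ((2 * L + 1) ^ 3 : ℕ) * ∑ z ∈ box 3 (2 * L), criticalTwoPoint 3 z := by
          rw [Finset.sum_const, card_box, nsmul_eq_mul]
      _ ≤ ((2 * L + 1) ^ 3 : ℕ) * (K * ((2 * L : ℕ) : ℝ) ^ 2) :=
          mul_le_mul_of_nonneg_left hT (by positivity)
      _ ≤ 27 * 4 * K * (L : ℝ) ^ 5 := by
          push_cast
          have h27 : (2 * (L : ℝ) + 1) ^ 3 ≤ 27 * (L : ℝ) ^ 3 := by
            have h3 : 2 * (L : ℝ) + 1 ≤ 3 * (L : ℝ) := by linarith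
            have h3' : (2 * (L : ℝ) + 1) ^ 3 ≤ (3 * (L : ℝ)) ^ 3 :=
              pow_le_pow_left₀ (by positivity) h3 3
            have e27 : (3 * (L : ℝ)) ^ 3 = 27 * (L : ℝ) ^ 3 := by ring
            rwa [e27] at h3'
          have hKL : 0 ≤ K * (2 * (L : ℝ)) ^ 2 := by positivity
          calc (2 * (L : ℝ) + 1) ^ 3 * (K * (2 * (L : ℝ)) ^ 2)
              ≤ 27 * (L : ℝ) ^ 3 * (K * (2 * (L : ℝ)) ^ 2) := mul_le_mul_of_nonneg_right h27 hKL
            _ = 27 * 4 * K * (L : ℝ) ^ 5 := by ring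

end Summit.CriticalPhenomena.Ising3DConformalLimit.PerfectScreeningCoulombImpliesNontrivial

end
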